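import Mathlib
import Summits.ValiantsHypothesis.ValiantsHypothesis.Theorems.RigidityForcesSymmetryRankRigidMinimalReprLaplaceTriangular

/-!
# The hybrid witness lemma: basis rows, charged constraints and bonuses (functional dual of `LaplaceOptimal`)
# (crux `RankRigidMinimalRepr`, stmt-ValiantsHypothesis-18034; frontier rung `LaplaceOptimalFive`, stmt-24813)

The general form of the greedy dual-witness construction behind `…LaplaceTriangular.lean` /
`…LaplaceTriangularBasis.lean`.  Slots `Fin n` are processed in the order `ord`.  The first `b` positions are BASIS
slots: their covectors are basis rows `e_{cb j}` (distinct columns).  Every TERM `t` of the purported decomposition is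
CHARGED to one slot `l t` (a general slot) and contributes there ONE linear condition whose coefficient vector
`Nv t φ` may depend on the covectors of the slots processed EARLIER (locality `hloc`) — this covers slices (constant
vector), pair terms killed through their 2-slot side (bilinear ⇒ linear in the later slot) or through their 3-slot
side (trilinear ⇒ linear in the last slot), etc.  A general slot at position `j` must also avoid the pivots of the
earlier general slots and the basis columns, except that ONE basis column may be left free at a slot owning a charged
constraint vector that never vanishes at that column («bonus»: then a non-zero solution cannot hide inside the basis
columns).  COUNT: at a general position `j` with slot `s` and `m_s` charged terms, `m_s + j ≤ n - 1`, or `m_s + j ≤ n`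
with a bonus.  Conclusion: covectors killing every charged constraint, with the prescribed basis rows, and NON-ZERO
PERMANENT (`permanent_eq_prod_of_multibasis`: basis rows pin their columns, the general rows are triangular).

General `n`; no new definitions.  HONEST FRAMING: infrastructure for the frontier rung `LaplaceOptimalFive`
(stmt-24813), which stays OPEN; nothing here bears on `VP ≠ VNP`.
-/

set_option autoImplicit false

-- the mandated summit-side namespace repeats a component by design (single-problem summit)
set_option linter.dupNamespace false

namespace Summit.ValiantsHypothesis.ValiantsHypothesis.Theorems.RigidityForcesSymmetryRankRigidMinimalRepr

namespace LaplaceTriangular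

open Finset Module

variable {n : ℕ}

/-! ### §1 The permanent with several basis rows -/

/-- **Triangular permanent with basis rows.**  Rows in `F` vanish off their pivots; among the rows outside `F`,
`φ_i(τ i') = 0` whenever `pos i' < pos i` (`pos` injective).  Then `per (φ_i(c))_{c,i} = Π_i φ_i(τ i)`. -/
theorem permanent_eq_prod_of_multibasis (φ : Fin n → Fin n → ℂ) (τ : Equiv.Perm (Fin n)) (pos : Fin n → ℕ)
    (hpos : Function.Injective pos) (F : Finset (Fin n)) (hF : ∀ f ∈ F, ∀ x, x ≠ τ f → φ f x = 0)
    (htri : ∀ i i', i ∉ F → i' ∉ F → pos i' < pos i → φ i (τ i') = 0) :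
    (Matrix.of fun c i => φ i c).permanent = ∏ i, φ i (τ i) := by
  classical
  unfold Matrix.permanent
  rw [sum_eq_single τ]
  · simp [Matrix.of_apply]
  · intro σ _ hστ
    simp only [Matrix.of_apply]
    set π : Equiv.Perm (Fin n) := σ.trans τ.symm with hπ
    have hτπ : ∀ i, τ (π i) = σ i := fun i => by simp [hπ]
    by_contra hprod
    have hall : ∀ i, φ i (σ i) ≠ 0 := fun i h => hprod (prod_eq_zero (mem_univ i) h)
    have hπf : ∀ f ∈ F, π f = f := by
      intro f hf'
      have hσf : σ f = τ f := by by_contra h; exact hall f (hF f hf' (σ f) h)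
      apply τ.injective; rw [hτπ, hσf]
    have hπne : ∀ i, i ∉ F → π i ∉ F := fun i hi h => hi (by
      have := hπf (π i) h
      rw [π.injective this] at h  -- π (π i) = π i ⇒ π i = i
      exact h)
    have hge : ∀ i ∈ (univ : Finset (Fin n)), pos i ≤ pos (π i) := by
      intro i _
      by_cases hi : i ∈ F
      · rw [hπf i hi]
      · by_contra hlt
        push Not at hlt
        have := htri i (π i) hi (hπne i hi) hlt
        rw [hτπ] at this
        exact hall i this
    have hsum : ∑ i, pos (π i) = ∑ i, pos i := Equiv.sum_comp π pos
    have heq := (sum_eq_sum_iff_of_le hge).mp hsum.symm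
    apply hστ
    ext i
    have h1 : i = π i := hpos (heq i (mem_univ i))
    have h2 := hτπ i
    rw [← h1] at h2
    exact congrArg Fin.val h2.symm
  · intro h; exact absurd (mem_univ τ) h

/-! ### §2 The hybrid greedy construction -/

/-- **Hybrid witness lemma.**  Data: the order `ord`; `b ≤ n` basis positions with distinct basis columns `cb j`
(`j < b`); terms `t : Fin N`, each charged to the slot `l t` with a constraint vector `Nv t φ` depending only on the
covectors of slots strictly before `l t` (`hloc`); no term is charged to a basis slot.  COUNT at every general position
`j ≥ b` (slot `s = ord j`, `m_s = #{t : l t = s}`): `m_s + j + 1 ≤ n`, or `m_s + j ≤ n` together with a term `t`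
charged at `s` and a basis column `cb r` at which `Nv t φ` never vanishes.  Then there are covectors `φ` with the basis
rows `φ (ord j) = e_{cb j}` (`j < b`), killing every charged constraint (`Σ_y φ_{l t}(y) (Nv t φ)(y) = 0`), with
`per (φ_i(c))_{c,i} ≠ 0`. -/
theorem hybrid_witness {N : ℕ} (ord : Equiv.Perm (Fin n)) (b : ℕ) (hb : b ≤ n) (cb : Fin n → Fin n)
    (hcb : ∀ j j' : Fin n, (j : ℕ) < b → (j' : ℕ) < b → cb j = cb j' → j = j')
    (l : Fin N → Fin n) (Nv : Fin N → (Fin n → Fin n → ℂ) → (Fin n → ℂ))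
    (hloc : ∀ t, ∀ φ φ' : Fin n → Fin n → ℂ, (∀ s, ord.symm s < ord.symm (l t) → φ s = φ' s) → Nv t φ = Nv t φ')
    (hbasis : ∀ t, b ≤ (ord.symm (l t) : ℕ))
    (hcount : ∀ j : Fin n, b ≤ (j : ℕ) →
      (univ.filter (fun t => l t = ord j)).card + (j : ℕ) + 1 ≤ n ∨
      ((univ.filter (fun t => l t = ord j)).card + (j : ℕ) ≤ n ∧
        ∃ t, l t = ord j ∧ ∃ r : Fin n, (r : ℕ) < b ∧ ∀ φ, Nv t φ (cb r) ≠ 0)) :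
    ∃ φ : Fin n → Fin n → ℂ,
      (∀ j : Fin n, (j : ℕ) < b → φ (ord j) = Pi.single (cb j) 1) ∧
      (∀ t, ∑ y, φ (l t) y * Nv t φ y = 0) ∧
      (Matrix.of fun c i => φ i c).permanent ≠ 0 := by
  classical
  -- INVARIANT after processing the positions `< j` (`b ≤ j ≤ n`): basis rows, pivots `c m` (`c m = cb m` for `m < b`),
  -- charged constraints of processed general slots killed, general rows avoid earlier general pivots, pivots injective,
  -- general pivots outside the basis columns
  have step : ∀ j : ℕ, b ≤ j → j ≤ n → ∃ (φ : Fin n → Fin n → ℂ) (c : Fin n → Fin n),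
      (∀ m : Fin n, (m : ℕ) < b → φ (ord m) = Pi.single (cb m) 1 ∧ c m = cb m) ∧
      (∀ m : Fin n, b ≤ (m : ℕ) → (m : ℕ) < j →
        (∀ t, l t = ord m → ∑ y, φ (ord m) y * Nv t φ y = 0) ∧
        φ (ord m) (c m) ≠ 0 ∧
        (∀ k : Fin n, b ≤ (k : ℕ) → k < m → φ (ord m) (c k) = 0) ∧
        (∀ k : Fin n, (k : ℕ) < b → c m ≠ cb k)) ∧
      (∀ m m' : Fin n, (m : ℕ) < j → (m' : ℕ) < j → c m = c m' → m = m') := by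
    intro j hbj hjn
    induction j with
    | zero =>
      have hb0 : b = 0 := by omega
      subst hb0
      exact ⟨fun _ _ => 0, fun m => m, fun m hm => absurd hm (by omega), fun m hm hm' => by omega,
        fun m m' hm _ _ => absurd hm (by omega)⟩
    | succ j ih =>
      rcases Nat.lt_or_ge j b with hjb | hjb
      · -- `j + 1 = b`: all processed positions are basis positions
        have hjb' : j + 1 = b := by omega
        refine ⟨fun s => if h : (ord.symm s : ℕ) < b then Pi.single (cb (ord.symm s)) 1 else 0,
          fun m => if (m : ℕ) < b then cb m else m, ?_, ?_, ?_⟩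
        · intro m hm
          refine ⟨?_, by simp [hm]⟩
          simp [Equiv.symm_apply_apply, hm]
        · intro m hm hm'; omega
        · intro m m' hm hm' hcc
          have h1 : (m : ℕ) < b := by omega
          have h2 : (m' : ℕ) < b := by omega
          simp only [h1, h2, if_true] at hcc
          exact hcb m m' h1 h2 hcc
      -- the genuine step: position `j ≥ b`
      obtain ⟨φ, c, hbas, hinv, hinj⟩ := ih hjb (by omega)
      set jf : Fin n := ⟨j, by omega⟩ with hjf
      set s : Fin n := ord jf with hs
      have hsj : ord.symm s = jf := by rw [hs, Equiv.symm_apply_apply]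
      -- constraint vectors at `s`: charged terms, earlier general pivots, basis columns (minus a bonus column)
      let Tch : Finset (Fin n → ℂ) := (univ.filter (fun t => l t = s)).image (fun t => Nv t φ)
      let Piv : Finset (Fin n → ℂ) :=
        (univ.filter (fun k : Fin n => b ≤ (k : ℕ) ∧ k < jf)).image (fun k => Pi.single (c k) 1)
      let Bas : Finset (Fin n) := (univ.filter (fun k : Fin n => (k : ℕ) < b)).image cb
      have hTch : Tch.card ≤ (univ.filter (fun t => l t = s)).card := card_image_le
      have hPiv : Piv.card ≤ j - b := by
        refine card_image_le.trans ?_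
        have : (univ.filter (fun k : Fin n => b ≤ (k : ℕ) ∧ k < jf)) ⊆ (Finset.Ico ⟨b, by omega⟩ jf) := by
          intro k hk
          simp only [mem_filter, mem_univ, true_and] at hk
          rw [Finset.mem_Ico, Fin.le_def]
          exact ⟨hk.1, hk.2⟩
        refine (card_le_card this).trans ?_
        rw [Fin.card_Ico]
      have hBas : Bas.card ≤ b := by
        refine card_image_le.trans ?_
        have : (univ.filter (fun k : Fin n => (k : ℕ) < b)) = Finset.Iio ⟨b, by omega⟩ := by
          ext k; simp [Finset.mem_Iio, Fin.lt_def]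
        rw [this, Fin.card_Iio]
      have hPiv_mem : ∀ k : Fin n, b ≤ (k : ℕ) → k < jf → Pi.single (c k) (1 : ℂ) ∈ Piv := fun k hk hk' => by
        simp only [Piv, mem_image, mem_filter, mem_univ, true_and]; exact ⟨k, ⟨hk, hk'⟩, rfl⟩
      have hBas_mem : ∀ k : Fin n, (k : ℕ) < b → cb k ∈ Bas := fun k hk => by
        simp only [Bas, mem_image, mem_filter, mem_univ, true_and]; exact ⟨k, hk, rfl⟩
      have hTch_mem : ∀ t, l t = s → Nv t φ ∈ Tch := fun t ht => by
        simp only [Tch, mem_image, mem_filter, mem_univ, true_and]; exact ⟨t, ht, rfl⟩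
      -- the new covector `ψ` and pivot `cj`: `ψ ⊥ Tch`, `ψ` vanishes on the earlier general pivots, `cj ∉` basis
      -- columns, `cj` not an earlier general pivot, `ψ cj ≠ 0`
      obtain ⟨ψ, cj, hψT, hψP, hcjB, hcj⟩ : ∃ (ψ : Fin n → ℂ) (cj : Fin n),
          (∀ t, l t = s → ∑ y, ψ y * Nv t φ y = 0) ∧
          (∀ k : Fin n, b ≤ (k : ℕ) → k < jf → ψ (c k) = 0) ∧
          (∀ k : Fin n, (k : ℕ) < b → cj ≠ cb k) ∧ ψ cj ≠ 0 := by
        have h2 := hcount jf (by rw [hjf]; exact hjb)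
        have hjv : (jf : ℕ) = j := rfl
        rw [← hs, hjv] at h2
        by_cases hbonus : ∃ t, l t = s ∧ ∃ r : Fin n, (r : ℕ) < b ∧ ∀ φ', Nv t φ' (cb r) ≠ 0
        · obtain ⟨t0, ht0, r, hr, hNr⟩ := hbonus
          let T : Finset (Fin n → ℂ) := Tch ∪ Piv ∪ (Bas.erase (cb r)).image (fun x => Pi.single x 1)
          have hT : T.card < n := by
            have h1 : T.card ≤ (univ.filter (fun t => l t = s)).card + (j - b) + (b - 1) := by
              refine (card_union_le _ _).trans ?_
              refine Nat.add_le_add ((card_union_le _ _).trans (Nat.add_le_add hTch hPiv)) ?_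
              refine card_image_le.trans ?_
              rw [card_erase_of_mem (hBas_mem r hr)]
              omega
            rcases h2 with h2 | ⟨h2, -⟩ <;> omega
          obtain ⟨ψ, hψ0, hψ⟩ := exists_ne_zero_orthogonal T hT
          have hψT : ∀ t, l t = s → ∑ y, ψ y * Nv t φ y = 0 := fun t ht =>
            hψ _ (by simp only [T, mem_union]; exact Or.inl (Or.inl (hTch_mem t ht)))
          have hψP : ∀ k : Fin n, b ≤ (k : ℕ) → k < jf → ψ (c k) = 0 := by
            intro k hk hk'
            have := hψ _ (by simp only [T, mem_union]; exact Or.inl (Or.inr (hPiv_mem k hk hk')))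
            simpa [Pi.single_apply] using this
          have hψB : ∀ k : Fin n, (k : ℕ) < b → cb k ≠ cb r → ψ (cb k) = 0 := by
            intro k hk hkr
            have := hψ (Pi.single (cb k) 1) (by
              simp only [T, mem_union, mem_image]
              exact Or.inr ⟨cb k, mem_erase.mpr ⟨hkr, hBas_mem k hk⟩, rfl⟩)
            simpa [Pi.single_apply] using this
          -- a pivot outside the basis columns: else `ψ ∝ e_{cb r}`, contradicting `ψ ⊥ Nv t0 φ`
          obtain ⟨cj, hcjB, hcj⟩ : ∃ x, (∀ k : Fin n, (k : ℕ) < b → x ≠ cb k) ∧ ψ x ≠ 0 := by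
            by_contra h
            push Not at h
            have hoff : ∀ x, x ≠ cb r → ψ x = 0 := by
              intro x hx
              by_cases hxB : ∃ k : Fin n, (k : ℕ) < b ∧ x = cb k
              · obtain ⟨k, hk, rfl⟩ := hxB; exact hψB k hk hx
              · push Not at hxB; exact h x (fun k hk => hxB k hk)
            have hsum := hψT t0 ht0
            rw [Fintype.sum_eq_single (cb r) (fun x hx => by rw [hoff x hx, zero_mul])] at hsum
            rcases mul_eq_zero.mp hsum with h1 | h1
            · apply hψ0; funext x
              by_cases hx : x = cb r
              · rw [hx, h1]; rfl
              · exact hoff x hx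
            · exact hNr φ h1
          exact ⟨ψ, cj, hψT, hψP, hcjB, hcj⟩
        · let T : Finset (Fin n → ℂ) := Tch ∪ Piv ∪ Bas.image (fun x => Pi.single x 1)
          have hT : T.card < n := by
            have h1 : T.card ≤ (univ.filter (fun t => l t = s)).card + (j - b) + b := by
              refine (card_union_le _ _).trans ?_
              exact Nat.add_le_add ((card_union_le _ _).trans (Nat.add_le_add hTch hPiv)) (card_image_le.trans hBas)
            rcases h2 with h2 | ⟨-, hb'⟩
            · omega
            · exact absurd hb' hbonus
          obtain ⟨ψ, hψ0, hψ⟩ := exists_ne_zero_orthogonal T hT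
          have hψT : ∀ t, l t = s → ∑ y, ψ y * Nv t φ y = 0 := fun t ht =>
            hψ _ (by simp only [T, mem_union]; exact Or.inl (Or.inl (hTch_mem t ht)))
          have hψP : ∀ k : Fin n, b ≤ (k : ℕ) → k < jf → ψ (c k) = 0 := by
            intro k hk hk'
            have := hψ _ (by simp only [T, mem_union]; exact Or.inl (Or.inr (hPiv_mem k hk hk')))
            simpa [Pi.single_apply] using this
          have hψB : ∀ k : Fin n, (k : ℕ) < b → ψ (cb k) = 0 := by
            intro k hk
            have := hψ (Pi.single (cb k) 1) (by
              simp only [T, mem_union, mem_image]; exact Or.inr ⟨cb k, hBas_mem k hk, rfl⟩)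
            simpa [Pi.single_apply] using this
          obtain ⟨cj, hcjB, hcj⟩ : ∃ x, (∀ k : Fin n, (k : ℕ) < b → x ≠ cb k) ∧ ψ x ≠ 0 := by
            by_contra h
            push Not at h
            apply hψ0; funext x
            by_cases hxB : ∃ k : Fin n, (k : ℕ) < b ∧ x = cb k
            · obtain ⟨k, hk, rfl⟩ := hxB; exact hψB k hk
            · push Not at hxB; exact h x (fun k hk => hxB k hk)
          exact ⟨ψ, cj, hψT, hψP, hcjB, hcj⟩
      -- pivots: `cj` differs from every earlier pivot
      have hcjP : ∀ k : Fin n, b ≤ (k : ℕ) → k < jf → cj ≠ c k := fun k hk hk' h => hcj (by rw [h]; exact hψP k hk hk')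
      have hjs : ∀ m : Fin n, (m : ℕ) < j → ord m ≠ s := fun m hm h => by
        have := ord.injective (h.trans hs); rw [this] at hm; exact lt_irrefl _ hm
      -- extend
      refine ⟨Function.update φ s ψ, Function.update c jf cj, ?_, ?_, ?_⟩
      · intro m hm
        obtain ⟨h1, h2⟩ := hbas m hm
        have hmj : m ≠ jf := fun h => by rw [h] at hm; exact absurd hm (by simp [hjf]; exact hjb)
        refine ⟨?_, ?_⟩
        · rw [Function.update_of_ne (hjs m (by omega))]; exact h1
        · rw [Function.update_of_ne hmj]; exact h2
      · intro m hbm hm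
        rcases Nat.lt_succ_iff_lt_or_eq.mp hm with hm' | hm'
        · -- an earlier general slot: unchanged (its constraint vectors only see earlier slots, all `≠ s`)
          have hmj : m ≠ jf := fun h => by rw [h] at hm'; exact lt_irrefl _ hm'
          have hms : ord m ≠ s := hjs m hm'
          obtain ⟨h1, h2, h3, h4⟩ := hinv m hbm hm'
          refine ⟨?_, ?_, ?_, ?_⟩
          · intro t ht
            have hN : Nv t (Function.update φ s ψ) = Nv t φ := by
              refine hloc t _ _ (fun s' hs' => Function.update_of_ne (fun h => ?_) _ _)
              rw [h, hsj, ht, Equiv.symm_apply_apply, Fin.lt_def] at hs'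
              exact absurd (lt_trans hs' hm') (lt_irrefl _)
            rw [hN, Function.update_of_ne hms]
            exact h1 t ht
          · rw [Function.update_of_ne hms, Function.update_of_ne hmj]; exact h2
          · intro k hk hkm
            have hkj : k ≠ jf := fun h => by
              rw [h, Fin.lt_def] at hkm; exact absurd (lt_trans hkm hm') (lt_irrefl _)
            rw [Function.update_of_ne hms, Function.update_of_ne hkj]
            exact h3 k hk hkm
          · intro k hk
            rw [Function.update_of_ne hmj]; exact h4 k hk
        · -- the new slot
          have hmj : m = jf := Fin.ext hm'
          have hom : ord m = s := by rw [hmj, hs]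
          refine ⟨?_, ?_, ?_, ?_⟩
          · intro t ht
            rw [hom] at ht
            have hN : Nv t (Function.update φ s ψ) = Nv t φ := by
              refine hloc t _ _ (fun s' hs' => Function.update_of_ne (fun h => ?_) _ _)
              rw [h, ht] at hs'; exact lt_irrefl _ hs'
            rw [hN, hom, Function.update_self]
            exact hψT t ht
          · rw [hom, hmj, Function.update_self, Function.update_self]; exact hcj
          · intro k hk hkm
            have hkj : k ≠ jf := fun h => by rw [h, hmj] at hkm; exact lt_irrefl _ hkm
            rw [hom, Function.update_self, Function.update_of_ne hkj]
            exact hψP k hk (by rw [hmj] at hkm; exact hkm)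
          · intro k hk
            rw [hmj, Function.update_self]; exact hcjB k hk
      · -- injectivity of all pivots
        intro m m' hm hm' hcc
        rcases Nat.lt_succ_iff_lt_or_eq.mp hm with h1 | h1 <;> rcases Nat.lt_succ_iff_lt_or_eq.mp hm' with h2 | h2
        · have hmj : m ≠ jf := fun h => by rw [h] at h1; exact lt_irrefl _ h1
          have hmj' : m' ≠ jf := fun h => by rw [h] at h2; exact lt_irrefl _ h2
          rw [Function.update_of_ne hmj, Function.update_of_ne hmj'] at hcc
          exact hinj m m' h1 h2 hcc
        · have hmj : m ≠ jf := fun h => by rw [h] at h1; exact lt_irrefl _ h1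
          have hm'j : m' = jf := Fin.ext h2
          rw [Function.update_of_ne hmj, hm'j, Function.update_self] at hcc
          exfalso
          rcases Nat.lt_or_ge (m : ℕ) b with hmb | hmb
          · exact hcjB m hmb (by rw [← hcc, (hbas m hmb).2])
          · exact hcjP m hmb (by rw [Fin.lt_def]; exact h1) hcc.symm
        · have hm'j : m' ≠ jf := fun h => by rw [h] at h2; exact lt_irrefl _ h2
          have hmj : m = jf := Fin.ext h1
          rw [Function.update_of_ne hm'j, hmj, Function.update_self] at hcc
          exfalso
          rcases Nat.lt_or_ge (m' : ℕ) b with hmb | hmb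
          · exact hcjB m' hmb (by rw [hcc, (hbas m' hmb).2])
          · exact hcjP m' hmb (by rw [Fin.lt_def]; exact h2) hcc
        · exact Fin.ext (by rw [h1, h2])
  -- all slots processed
  obtain ⟨φ, c, hbas, hinv, hinj⟩ := step n hb le_rfl
  have hcinj : Function.Injective c := fun m m' h => hinj m m' m.isLt m'.isLt h
  let cperm : Equiv.Perm (Fin n) := Equiv.ofBijective c (Finite.injective_iff_bijective.mp hcinj)
  let F : Finset (Fin n) := (univ.filter (fun k : Fin n => (k : ℕ) < b)).image ord
  have hFmem : ∀ i, i ∈ F ↔ (ord.symm i : ℕ) < b := by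
    intro i
    simp only [F, mem_image, mem_filter, mem_univ, true_and]
    constructor
    · rintro ⟨k, hk, rfl⟩; simpa using hk
    · intro h; exact ⟨ord.symm i, h, by simp⟩
  refine ⟨φ, fun j hj => (hbas j hj).1, ?_, ?_⟩
  · intro t
    have := (hinv (ord.symm (l t)) (hbasis t) (ord.symm (l t)).isLt).1 t (by simp)
    simpa using this
  · rw [permanent_eq_prod_of_multibasis φ (ord.symm.trans cperm) (fun i => (ord.symm i : ℕ))
      (fun i i' h => ord.symm.injective (Fin.ext h)) F ?_ ?_]
    · refine prod_ne_zero_iff.mpr fun i _ => ?_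
      by_cases hi : (ord.symm i : ℕ) < b
      · obtain ⟨h1, h2⟩ := hbas (ord.symm i) hi
        have e : (ord.symm.trans cperm) i = cb (ord.symm i) := by simp [cperm, h2]
        rw [Equiv.apply_symm_apply] at h1
        rw [e, h1]; simp
      · push Not at hi
        have := (hinv (ord.symm i) hi (ord.symm i).isLt).2.1
        simpa [cperm] using this
    · intro f hf x hx
      have hfb := (hFmem f).mp hf
      obtain ⟨h1, h2⟩ := hbas (ord.symm f) hfb
      rw [Equiv.apply_symm_apply] at h1
      have e : (ord.symm.trans cperm) f = cb (ord.symm f) := by simp [cperm, h2]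
      rw [e] at hx
      rw [h1]; simp [hx]
    · intro i i' hi hi' hlt
      have hbi : b ≤ (ord.symm i : ℕ) := by have := (hFmem i).not.mp hi; omega
      have hbi' : b ≤ (ord.symm i' : ℕ) := by have := (hFmem i').not.mp hi'; omega
      have := (hinv (ord.symm i) hbi (ord.symm i).isLt).2.2.1 (ord.symm i') hbi' (by rw [Fin.lt_def]; exact hlt)
      simpa [cperm] using this

end LaplaceTriangular

end Summit.ValiantsHypothesis.ValiantsHypothesis.Theorems.RigidityForcesSymmetryRankRigidMinimalRepr
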